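import Summits.Langlands.Langlands.Theses.NonParallelVoid
import Summits.Langlands.Langlands.Theorems.IrreducibilityBySelfDualityReciprocityUpToIrreducibilityCorrespondsConj
import Literature.FieldTheory.AlgClosed.PadicAlgClEquivComplex
import HarnessLib

/-!
# Route NonParallelVoid — crux `VoidToLanglands` (stmt-Langlands-17006), line `satake-sector-cut`:
# stub U (`stub_avatarConjugacy`) and the texts-only composition of the line (`--supports` file)

`VoidToLanglands := Target → Langlands` is the route's declared remainder (rank 9).  The registered line
`Cruxes/VoidToLanglands/Lines/satake_sector_cut.lean` (crux-strategist, 2026-08-17; re-registered by the lead,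
7 stubs) cuts `Langlands` (the `∀ 𝓡` summit) FIRST by level — Satake-level existence/automorphy versus
local–global compatibility, along the typed partition of route PrimeSwitchSplit (RD ⊓ W⁺ ⊓ P ⊓ L∤∀ ⊓ U ⊓ B_w)
re-typed for `∀ 𝓡` — and THEN cuts the Satake-level automorphy leaf B_w along the route's sector
𝔖 := `n = 2 ∧ F imaginary quadratic ∧ ρ regular at every label above ℓ`, so that the antecedent `Target`
(non-parallel regular weights are void) is load-bearing: on 𝔖 it makes the weights PARALLEL and the leaf
B_w⁺ (weak parallel modularity over imaginary quadratic fields) applies.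

This file
* closes the registered stub **U = `stub_avatarConjugacy`** (VERBATIM item stmt-Langlands-17844): two framed
  `ℓ`-adic representations Satake–Frobenius compatible almost everywhere with one cuspidal `π`, the first
  irreducible, are `GL_n(ℚ̄_ℓ)`-conjugate — a corollary of the landed
  `ReciprocityUpToIrreducibility.isConjugate_of_satakeFrobCompatibleAt` (Chebotarev + Brauer–Nesbitt,
  Deligne–Serre Lemme 3.2; p119850);
* records the landable TEXTS-ONLY twin of the skeleton's kernel-checked composition
  `SatakeSectorCut.VoidToLanglands_of`: `nonParallelVoid_voidToLanglands_of_leaves`, the seven leaves spelled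
  out as hypotheses (five are VERBATIM the statements of served items stmt-Langlands-17930 / 17415 / 17534 /
  the `∀ Rec` text of 17417 / 17844; B_w⁻ is stmt-Langlands-17414 restricted to `¬ 𝔖`; B_w⁺ is new and
  `Target`-fed), conclusion the route decl BY NAME, every hypothesis used — the glue a route-level split
  `VoidToLanglands ⇐ {RD, W⁺, P, L∤∀, U, B_w⁻, B_w⁺}` needs (Cruxes/VoidToLanglands/STRATEGY-CENSUS.md §Install).
  Pure logic over the summit's definitions: `hprime` (every finite place misses 2 or 3), the local–global
  helper (P(i), L∤∀, and above `ℓ` the prime switch P(ii) through an `ℓ'`-adic avatar from W⁺), weak (B) by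
  `by_cases 𝔖` with the `Target` splice, then (A) = W⁺ + helper + U and (B) = weak (B) + helper.

No definitions; standard axioms only.

References: [BuzzardGeeLMS2014] Conj. 3.2.1–3.2.2; [FontaineMazurGeometric1995] Conj. 1;
[TaylorGaloisRepresentations2004] Conj. 7–8; [DeligneSerreASENS1974] Lemme 3.2; [CalegariMazur2008] Conj. 1.3.
-/

set_option linter.dupNamespace false -- `Summit.Langlands.Langlands` is the mandated namespace

noncomputable section

open scoped BigOperators Topology Classical Matrix NumberField
open Filter IsDedekindDomain
open Summit.Langlands

namespace Summit.Langlands.Langlands.Theorems.NonParallelVoidSatakeSectorCut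

/-- **Registered stub U = `stub_avatarConjugacy` of line `satake-sector-cut` (verbatim; = item
stmt-Langlands-17844 `PrimeSwitchSplit.AvatarConjugacy`)**: two framed `ℓ`-adic representations of `Γ_K`
that are Satake–Frobenius compatible at almost all places with the same cuspidal `π` (via `ι`), the first
of them irreducible, are conjugate under `GL_n(ℚ̄_ℓ)`.  Uniqueness of Satake parameters, Chebotarev density,
Brauer–Nesbitt in characteristic zero, equivalent framed representations are conjugate — in the tree as
`ReciprocityUpToIrreducibility.isConjugate_of_satakeFrobCompatibleAt`. [cite: DeligneSerreASENS1974, Lemme 3.2] -/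
theorem stub_avatarConjugacy :
    ∀ (K : Type) [Field K] [NumberField K] (n : ℕ) (hcpt : Literature.NumberTheory.Automorphic.isCompact_glFiniteIntegralLevel n K) (π : Literature.NumberTheory.Automorphic.CuspidalAutomorphicRepData n K hcpt) (ℓ : ℕ) [Fact ℓ.Prime] (ι : PadicAlgCl ℓ ≃+* ℂ) (ρ₀ ρ : Literature.NumberTheory.GaloisRepresentations.FramedGaloisRep K (PadicAlgCl ℓ) n), ρ₀.toGaloisRep.IsIrreducible → (∀ᶠ v : IsDedekindDomain.HeightOneSpectrum (NumberField.RingOfIntegers K) in cofinite, SatakeFrobCompatibleAt ι π.1 ρ₀ v) → (∀ᶠ v : IsDedekindDomain.HeightOneSpectrum (NumberField.RingOfIntegers K) in cofinite, SatakeFrobCompatibleAt ι π.1 ρ v) → IsConjugate ρ₀ ρ :=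
  fun _K _ _ _n _hcpt π _ℓ _ ι _ρ₀ _ρ h₀ hρ₀ hρ =>
    ReciprocityUpToIrreducibility.isConjugate_of_satakeFrobCompatibleAt π.1 ι h₀ hρ₀ hρ

/-- **`NonParallelVoid.VoidToLanglands` from the seven leaves of line `satake-sector-cut`** (texts only).
Hypotheses, in order: RD (reciprocity data exist, = stmt-Langlands-17930), W⁺ (irreducible Satake avatar of
every L-algebraic cuspidal `π`, = stmt-Langlands-17415), P (de Rham member + prime switch, =
stmt-Langlands-17534), L∤∀ (Taylor's Conj. 7 away from `ℓ` for every datum, the `∀ Rec` text of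
stmt-Langlands-17417), U (conjugacy of irreducible Satake avatars, = stmt-Langlands-17844), B_w⁻ (Satake-level
automorphy off the sector 𝔖), B_w⁺ (weak PARALLEL modularity over imaginary quadratic fields — the leaf fed
by `Target`).  Proof: given `Target`, fix `F`; non-vacuity from RD; for every datum `Rec` the local–global
helper; weak (B) by the sector split (on 𝔖, `Target` makes the regular weights parallel); then (A) and (B).
[cite: BuzzardGeeLMS2014, Conj. 3.2.1 and Conj. 3.2.2] [cite: CalegariMazur2008, Conj. 1.3] -/
theorem nonParallelVoid_voidToLanglands_of_leaves
    (hRD : ∀ (F : Type) [Field F] [NumberField F], Nonempty (Summit.Langlands.ReciprocityData F))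
    (hW : ∀ (K : Type) [Field K] [NumberField K] (n : ℕ) (hcpt : Literature.NumberTheory.Automorphic.isCompact_glFiniteIntegralLevel n K), 0 < n → ∀ (π : Literature.NumberTheory.Automorphic.CuspidalAutomorphicRepData n K hcpt), π.1.IsLAlgebraic → ∀ (ℓ : ℕ) [Fact ℓ.Prime] (ι : PadicAlgCl ℓ ≃+* ℂ), ∃ ρ : Literature.NumberTheory.GaloisRepresentations.FramedGaloisRep K (PadicAlgCl ℓ) n, ρ.toGaloisRep.IsIrreducible ∧ ∀ᶠ v : IsDedekindDomain.HeightOneSpectrum (NumberField.RingOfIntegers K) in cofinite, SatakeFrobCompatibleAt ι π.1 ρ v)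
    (hP : ∀ (K : Type) [Field K] [NumberField K] (n : ℕ) (hcpt : Literature.NumberTheory.Automorphic.isCompact_glFiniteIntegralLevel n K), 0 < n → ∀ (π : Literature.NumberTheory.Automorphic.CuspidalAutomorphicRepData n K hcpt), π.1.IsLAlgebraic → ∀ (ℓ : ℕ) [Fact ℓ.Prime] (ι : PadicAlgCl ℓ ≃+* ℂ) (ρ : Literature.NumberTheory.GaloisRepresentations.FramedGaloisRep K (PadicAlgCl ℓ) n), ρ.toGaloisRep.IsIrreducible → (∀ᶠ v : IsDedekindDomain.HeightOneSpectrum (NumberField.RingOfIntegers K) in cofinite, SatakeFrobCompatibleAt ι π.1 ρ v) → ∀ (v : IsDedekindDomain.HeightOneSpectrum (NumberField.RingOfIntegers K)) (hv : ((ℓ : ℕ) : NumberField.RingOfIntegers K) ∈ v.asIdeal), (Literature.NumberTheory.PAdicHodge.fontainePstAdicCompletion v ℓ hv).IsDeRhamFramed (ρ.toLocal v) ∧ ∀ (Rec : ReciprocityData K) (ℓ' : ℕ) [Fact ℓ'.Prime] (ι' : PadicAlgCl ℓ' ≃+* ℂ) (ρ' : Literature.NumberTheory.GaloisRepresentations.FramedGaloisRep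 K (PadicAlgCl ℓ') n), ((ℓ' : ℕ) : NumberField.RingOfIntegers K) ∉ v.asIdeal → ρ'.toGaloisRep.IsIrreducible → (∀ᶠ w : IsDedekindDomain.HeightOneSpectrum (NumberField.RingOfIntegers K) in cofinite, SatakeFrobCompatibleAt ι' π.1 ρ' w) → LocalGlobalCompatibleAt Rec ι' π.1 ρ' v → LocalGlobalCompatibleAt Rec ι π.1 ρ v)
    (hA : ∀ (K : Type) [Field K] [NumberField K] (Rec : ReciprocityData K) (n : ℕ) (hcpt : Literature.NumberTheory.Automorphic.isCompact_glFiniteIntegralLevel n K), 0 < n → ∀ (π : Literature.NumberTheory.Automorphic.CuspidalAutomorphicRepData n K hcpt), π.1.IsLAlgebraic → ∀ (ℓ : ℕ) [Fact ℓ.Prime] (ι : PadicAlgCl ℓ ≃+* ℂ) (ρ : Literature.NumberTheory.GaloisRepresentations.FramedGaloisRep K (PadicAlgCl ℓ) n), ρ.toGaloisRep.IsIrreducible → ((∀ᶠ v : IsDedekindDomain.HeightOneSpectrum (NumberField.RingOfIntegers K) in cofinite, ρ.IsUnramifiedAt v) ∧ ∀ (v : IsDedekindDomain.HeightOneSpectrum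 (NumberField.RingOfIntegers K)) (hv : ((ℓ : ℕ) : NumberField.RingOfIntegers K) ∈ v.asIdeal), (Literature.NumberTheory.PAdicHodge.fontainePstAdicCompletion v ℓ hv).IsDeRhamFramed (ρ.toLocal v)) → (∀ᶠ v : IsDedekindDomain.HeightOneSpectrum (NumberField.RingOfIntegers K) in cofinite, SatakeFrobCompatibleAt ι π.1 ρ v) → ∀ v : IsDedekindDomain.HeightOneSpectrum (NumberField.RingOfIntegers K), ((ℓ : ℕ) : NumberField.RingOfIntegers K) ∉ v.asIdeal → LocalGlobalCompatibleAt Rec ι π.1 ρ v)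
    (hU : ∀ (K : Type) [Field K] [NumberField K] (n : ℕ) (hcpt : Literature.NumberTheory.Automorphic.isCompact_glFiniteIntegralLevel n K) (π : Literature.NumberTheory.Automorphic.CuspidalAutomorphicRepData n K hcpt) (ℓ : ℕ) [Fact ℓ.Prime] (ι : PadicAlgCl ℓ ≃+* ℂ) (ρ₀ ρ : Literature.NumberTheory.GaloisRepresentations.FramedGaloisRep K (PadicAlgCl ℓ) n), ρ₀.toGaloisRep.IsIrreducible → (∀ᶠ v : IsDedekindDomain.HeightOneSpectrum (NumberField.RingOfIntegers K) in cofinite, SatakeFrobCompatibleAt ι π.1 ρ₀ v) → (∀ᶠ v : IsDedekindDomain.HeightOneSpectrum (NumberField.RingOfIntegers K) in cofinite, SatakeFrobCompatibleAt ι π.1 ρ v) → IsConjugate ρ₀ ρ)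
    (hOff : ∀ (K : Type) [Field K] [NumberField K] (n : ℕ) (hcpt : Literature.NumberTheory.Automorphic.isCompact_glFiniteIntegralLevel n K), 0 < n → ∀ (ℓ : ℕ) [Fact ℓ.Prime] (ι : PadicAlgCl ℓ ≃+* ℂ) (ρ : Literature.NumberTheory.GaloisRepresentations.FramedGaloisRep K (PadicAlgCl ℓ) n), ρ.toGaloisRep.IsIrreducible → ((∀ᶠ v : IsDedekindDomain.HeightOneSpectrum (NumberField.RingOfIntegers K) in cofinite, ρ.IsUnramifiedAt v) ∧ ∀ (v : IsDedekindDomain.HeightOneSpectrum (NumberField.RingOfIntegers K)) (hv : ((ℓ : ℕ) : NumberField.RingOfIntegers K) ∈ v.asIdeal), (Literature.NumberTheory.PAdicHodge.fontainePstAdicCompletion v ℓ hv).IsDeRhamFramed (ρ.toLocal v)) → ¬ (n = 2 ∧ Algebra.IsQuadraticExtension ℚ K ∧ NumberField.IsTotallyComplex K ∧ ∀ (v : IsDedekindDomain.HeightOneSpectrum (NumberField.RingOfIntegers K)) (hv : ((ℓ : ℕ) : NumberField.RingOfIntegers K) ∈ v.asIdeal), letI := (Literature.NumberTheory.PAdicHodge.fontainePstAdicCompletion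 v ℓ hv).algebra; ∀ τ : v.adicCompletion K →ₐ[ℚ_[ℓ]] PadicAlgCl ℓ, ∃ a b : ℤ, a < b ∧ ρ.labelledHodgeTateWeightsAt v (Literature.NumberTheory.PAdicHodge.fontainePstAdicCompletion v ℓ hv).algebra (Literature.NumberTheory.PAdicHodge.fontainePstAdicCompletion v ℓ hv).𝔅 τ.toRingHom = {a, b}) → ∃ π : Literature.NumberTheory.Automorphic.CuspidalAutomorphicRepData n K hcpt, π.1.IsLAlgebraic ∧ ∀ᶠ v : IsDedekindDomain.HeightOneSpectrum (NumberField.RingOfIntegers K) in cofinite, SatakeFrobCompatibleAt ι π.1 ρ v)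
    (hPar : ∀ (F : Type) [Field F] [NumberField F] [Algebra.IsQuadraticExtension ℚ F], NumberField.IsTotallyComplex F → ∀ (hcpt : Literature.NumberTheory.Automorphic.isCompact_glFiniteIntegralLevel 2 F) (ℓ : ℕ) [Fact ℓ.Prime] (ι : PadicAlgCl ℓ ≃+* ℂ) (ρ : Literature.NumberTheory.GaloisRepresentations.FramedGaloisRep F (PadicAlgCl ℓ) 2), ρ.toGaloisRep.IsIrreducible → ((∀ᶠ v : IsDedekindDomain.HeightOneSpectrum (NumberField.RingOfIntegers F) in cofinite, ρ.IsUnramifiedAt v) ∧ ∀ (v : IsDedekindDomain.HeightOneSpectrum (NumberField.RingOfIntegers F)) (hv : ((ℓ : ℕ) : NumberField.RingOfIntegers F) ∈ v.asIdeal), (Literature.NumberTheory.PAdicHodge.fontainePstAdicCompletion v ℓ hv).IsDeRhamFramed (ρ.toLocal v)) → (∀ (v : IsDedekindDomain.HeightOneSpectrum (NumberField.RingOfIntegers F)) (hv : ((ℓ : ℕ) : NumberField.RingOfIntegers F) ∈ v.asIdeal), letI := (Literature.NumberTheory.PAdicHodge.fontainePstAdicCompletion v ℓ hv).algebra; ∀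 τ : v.adicCompletion F →ₐ[ℚ_[ℓ]] PadicAlgCl ℓ, ∃ a b : ℤ, a < b ∧ ρ.labelledHodgeTateWeightsAt v (Literature.NumberTheory.PAdicHodge.fontainePstAdicCompletion v ℓ hv).algebra (Literature.NumberTheory.PAdicHodge.fontainePstAdicCompletion v ℓ hv).𝔅 τ.toRingHom = {a, b}) → (∃ g : ℤ, ∀ (v : IsDedekindDomain.HeightOneSpectrum (NumberField.RingOfIntegers F)) (hv : ((ℓ : ℕ) : NumberField.RingOfIntegers F) ∈ v.asIdeal), letI := (Literature.NumberTheory.PAdicHodge.fontainePstAdicCompletion v ℓ hv).algebra; ∀ τ : v.adicCompletion F →ₐ[ℚ_[ℓ]] PadicAlgCl ℓ, ∃ a : ℤ, ρ.labelledHodgeTateWeightsAt v (Literature.NumberTheory.PAdicHodge.fontainePstAdicCompletion v ℓ hv).algebra (Literature.NumberTheory.PAdicHodge.fontainePstAdicCompletion v ℓ hv).𝔅 τ.toRingHom = {a, a + g}) → ∃ π : Literature.NumberTheory.Automorphic.CuspidalAutomorphicRepData 2 F hcpt, π.1.IsLAlgebraic ∧ ∀ᶠ v : IsDedekindDomain.HeightOneSpectrum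 (NumberField.RingOfIntegers F) in cofinite, SatakeFrobCompatibleAt ι π.1 ρ v) :
    Summit.Langlands.Langlands.Theses.NonParallelVoid.VoidToLanglands := by
  intro hT F _ _
  refine ⟨hRD F, fun Rec n hn hcpt => ?_⟩
  -- every finite place misses the prime 2 or the prime 3
  have hprime : ∀ v : IsDedekindDomain.HeightOneSpectrum (NumberField.RingOfIntegers F),
      ∃ (ℓ' : ℕ) (_ : Fact ℓ'.Prime), ((ℓ' : ℕ) : NumberField.RingOfIntegers F) ∉ v.asIdeal := by
    intro v
    by_cases h2 : ((2 : ℕ) : NumberField.RingOfIntegers F) ∈ v.asIdeal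
    · refine ⟨3, ⟨Nat.prime_three⟩, fun h3 => v.isPrime.ne_top ((Ideal.eq_top_iff_one _).2 ?_)⟩
      have h := v.asIdeal.sub_mem h3 h2
      have h1 : ((3 : ℕ) : NumberField.RingOfIntegers F) - ((2 : ℕ) : NumberField.RingOfIntegers F) = 1 := by
        push_cast; norm_num
      rwa [h1] at h
    · exact ⟨2, ⟨Nat.prime_two⟩, h2⟩
  -- the local–global helper for the datum `Rec`: geometric + compatible at EVERY finite place, for
  -- irreducible Satake–Frobenius compatible pairs; above ℓ the place is read through a prime below it
  have hLGC : ∀ (π : Literature.NumberTheory.Automorphic.CuspidalAutomorphicRepData n F hcpt), π.1.IsLAlgebraic →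
      ∀ (ℓ : ℕ) [Fact ℓ.Prime] (ι : PadicAlgCl ℓ ≃+* ℂ)
        (ρ : Literature.NumberTheory.GaloisRepresentations.FramedGaloisRep F (PadicAlgCl ℓ) n),
        ρ.toGaloisRep.IsIrreducible →
        (∀ᶠ v : IsDedekindDomain.HeightOneSpectrum (NumberField.RingOfIntegers F) in cofinite,
          SatakeFrobCompatibleAt ι π.1 ρ v) →
        IsGeometricFramed Rec ρ ∧
          ∀ v : IsDedekindDomain.HeightOneSpectrum (NumberField.RingOfIntegers F),
            LocalGlobalCompatibleAt Rec ι π.1 ρ v := by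
    intro π hL ℓ _ ι ρ hirr hρ
    have hgeo : (∀ᶠ v : IsDedekindDomain.HeightOneSpectrum (NumberField.RingOfIntegers F) in cofinite,
        ρ.IsUnramifiedAt v) ∧
        ∀ (v : IsDedekindDomain.HeightOneSpectrum (NumberField.RingOfIntegers F))
          (hv : ((ℓ : ℕ) : NumberField.RingOfIntegers F) ∈ v.asIdeal),
          (Literature.NumberTheory.PAdicHodge.fontainePstAdicCompletion v ℓ hv).IsDeRhamFramed
            (ρ.toLocal v) :=
      ⟨hρ.mono fun v ⟨_, _, hur, _⟩ => hur, fun v hv => (hP F n hcpt hn π hL ℓ ι ρ hirr hρ v hv).1⟩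
    refine ⟨hgeo, fun v => ?_⟩
    by_cases hv : ((ℓ : ℕ) : NumberField.RingOfIntegers F) ∈ v.asIdeal
    · obtain ⟨ℓ', _, hℓ'⟩ := hprime v
      obtain ⟨ι'⟩ := PadicAlgCl.nonempty_ringEquiv_complex ℓ'
      obtain ⟨ρ', hirr', hρ'⟩ := hW F n hcpt hn π hL ℓ' ι'
      have hgeo' : (∀ᶠ w : IsDedekindDomain.HeightOneSpectrum (NumberField.RingOfIntegers F) in cofinite,
          ρ'.IsUnramifiedAt w) ∧
          ∀ (w : IsDedekindDomain.HeightOneSpectrum (NumberField.RingOfIntegers F))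
            (hw : ((ℓ' : ℕ) : NumberField.RingOfIntegers F) ∈ w.asIdeal),
            (Literature.NumberTheory.PAdicHodge.fontainePstAdicCompletion w ℓ' hw).IsDeRhamFramed
              (ρ'.toLocal w) :=
        ⟨hρ'.mono fun w ⟨_, _, hur, _⟩ => hur,
          fun w hw => (hP F n hcpt hn π hL ℓ' ι' ρ' hirr' hρ' w hw).1⟩
      -- the prime switch: compatibility with the ℓ'-adic avatar at v, moved to the ℓ-adic one by P(ii)
      exact (hP F n hcpt hn π hL ℓ ι ρ hirr hρ v hv).2 Rec ℓ' ι' ρ' hℓ' hirr' hρ'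
        (hA F Rec n hcpt hn π hL ℓ' ι' ρ' hirr' hgeo' hρ' v hℓ')
    · exact hA F Rec n hcpt hn π hL ℓ ι ρ hirr hgeo hρ v hv
  -- weak (B) for this (F, n): Satake-level automorphy of every irreducible geometric ρ, by the SECTOR CUT;
  -- on the sector the non-parallel weights are emptied by `Target`
  have hBw : ∀ (ℓ : ℕ) [Fact ℓ.Prime] (ι : PadicAlgCl ℓ ≃+* ℂ)
      (ρ : Literature.NumberTheory.GaloisRepresentations.FramedGaloisRep F (PadicAlgCl ℓ) n),
      ρ.toGaloisRep.IsIrreducible → IsGeometricFramed Rec ρ →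
      ∃ π : Literature.NumberTheory.Automorphic.CuspidalAutomorphicRepData n F hcpt, π.1.IsLAlgebraic ∧
        ∀ᶠ v : IsDedekindDomain.HeightOneSpectrum (NumberField.RingOfIntegers F) in cofinite,
          SatakeFrobCompatibleAt ι π.1 ρ v := by
    intro ℓ _ ι ρ hirr hgeo
    by_cases hs : (n = 2 ∧ Algebra.IsQuadraticExtension ℚ F ∧ NumberField.IsTotallyComplex F ∧ ∀ (v : IsDedekindDomain.HeightOneSpectrum (NumberField.RingOfIntegers F)) (hv : ((ℓ : ℕ) : NumberField.RingOfIntegers F) ∈ v.asIdeal), letI := (Literature.NumberTheory.PAdicHodge.fontainePstAdicCompletion v ℓ hv).algebra; ∀ τ : v.adicCompletion F →ₐ[ℚ_[ℓ]] PadicAlgCl ℓ, ∃ a b : ℤ, a < b ∧ ρ.labelledHodgeTateWeightsAt v (Literature.NumberTheory.PAdicHodge.fontainePstAdicCompletion v ℓ hv).algebra (Literature.NumberTheory.PAdicHodge.fontainePstAdicCompletion v ℓ hv).𝔅 τ.toRingHom = {a, b})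
    · obtain ⟨rfl, hq, hc, hreg⟩ := hs
      haveI := hq
      -- `Target`: on the sector every regular `ρ` has parallel gaps
      have hpar := hT F hc ℓ ρ hirr hgeo.1 (fun v hv => ⟨hgeo.2 v hv, hreg v hv⟩)
      exact hPar F hc hcpt ℓ ι ρ hirr hgeo hreg hpar
    · exact hOff F n hcpt hn ℓ ι ρ hirr hgeo hs
  refine ⟨?_, ?_⟩
  · -- (A) automorphic → Galois, with uniqueness up to conjugacy from U
    intro π hL ℓ _ ι
    obtain ⟨ρ, hirr, hρ⟩ := hW F n hcpt hn π hL ℓ ι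
    obtain ⟨hgeo, hloc⟩ := hLGC π hL ℓ ι ρ hirr hρ
    exact ⟨ρ, hirr, hgeo, ⟨hρ, hloc⟩, fun ρ' h' => hU F n hcpt π ℓ ι ρ ρ' hirr hρ h'.1⟩
  · -- (B) Galois → automorphic
    intro ℓ _ ι ρ hirr hgeo
    obtain ⟨π, hL, hρ⟩ := hBw ℓ ι ρ hirr hgeo
    exact ⟨π, hL, hρ, (hLGC π hL ℓ ι ρ hirr hρ).2⟩

end Summit.Langlands.Langlands.Theorems.NonParallelVoidSatakeSectorCut

end
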